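import Literature.Geometry.Lorentzian.CarterThroatTransport
import Literature.Geometry.Lorentzian.CarterThroatHandover
import Literature.Geometry.Lorentzian.TeukolskyFarEnvelope
import Literature.Geometry.Lorentzian.KerrSurfaceGravity
import Summits.FinalStateConjecture.FinalStateConjecture.Theorems.PhaseMixingCaptureKappaExplicitWaveDecayOlverNormalForm

/-!
# Polynomial sup bound for the infinity-normalised radial solution beyond the collar, on a bounded box
# (stub `stub_infinitySupBoxPoly`, T1i of the line `olver-dunster-uniform-reduction`)

Crux `PhaseMixingCapture.KappaExplicitWaveDecay` (stmt-FinalStateConjecture-10654), line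
`olver-dunster-uniform-reduction`, stub T1i (skeleton v8). For the scalar radial Teukolsky solution
`R_𝓘` normalised at `𝓘⁺` (Teixeira da Costa 2020, Def. 2.3, `s = 0`) on sub-extremal Kerr, in the
cone `|ω − mω₊| ≤ ε₀|m|` with `m ≠ 0` and `Λ ≤ Λ₀`, we prove

  `√(r′² + a²)‖R_𝓘(r′)‖ ≤ C·Λ^N·κ^{-N}`  for all `r′ ≥ r₊ + θ(r₊ − r₋)`,

with `C, N` depending on `M, θ, Λ₀` only (`κ = Kerr.surfaceGravity M a`). The threshold /
superradiant restriction of the registered statement is not needed.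

## Proof (inward from infinity; every constant a box constant times a power of `κ⁻¹`)

`a₁ = M/2`, `ε₀ = 1/(16M)`, `μ = √(max Λ₀ 2)`, `R₀ = 256Mμ` (`Kerr.cone_box_constants`). FAR
`r′ ≥ R₀`: `√(r′² + a²)‖R_𝓘‖ ≤ 2` (`Kerr.Costa2019.farEnvelope`). THROAT
`θ ≤ x′ = (r′ − r₊)/(r₊ − r₋) < X₀ = (R₀ − r₊)/(r₊ − r₋) ≤ (128μ/M)κ⁻¹`: the blown-up normal form
`W″ = QW`, `W = √(x(x+1))·R_𝓘(r₊ + (r₊ − r₋)x)` (`stub_olverNormalForm`), the handover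
`‖W X₀‖ + X₀‖W′ X₀‖ ≤ (X₀+1)²h₀` at `R₀` (`Kerr.throat_handover` fed by `farEnvelope`), and the
a priori transport `Kerr.throat_norm_le` (Euler zone `x ≥ c|ξ|` by `EulerZoneGrowth`, oscillatory
pocket `x ≤ c|ξ|` by Sonin's envelope; uniform in `ξ = (ω − mω₊)/(2κ)`) give
`‖W x′‖ ≤ F(X₀/θ)^{n+1}(X₀+1)²h₀`; finally `√(r′² + a²)‖R_𝓘 r′‖ ≤ ((R₀ + M)/θ)‖W x′‖`,
`X₀^{n+3} ≤ ((128μ/M)κ⁻¹)^{n+3}`, `κ⁻¹ ≥ 4M`, `Λ ≥ 1`.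

No unproved fact is used.
-/

-- the doubled `FinalStateConjecture.FinalStateConjecture` path component trips dupNamespace
set_option linter.dupNamespace false

noncomputable section

namespace Summit.FinalStateConjecture.FinalStateConjecture.Theorems.KappaExplicitWaveDecay.OlverDunsterUniformReduction

open Literature.Geometry.Lorentzian Literature.Analysis.ODE
open MeasureTheory Filter Set Complex
open scoped Topology ComplexConjugate

/-! ### The far zone in the `r`-variable -/

/-- **Far-zone data of the infinity-normalised solution** (`Kerr.Costa2019.farEnvelope`, square roots
taken): for `r ≥ max(7M, √(12Λ)/|ω|, 1/(Mω²))`, `√(r² + a²)‖R r‖ ≤ 2` and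
`(Δ/(r² + a²))‖d/dr[√(r² + a²)R](r)‖ ≤ √2|ω|`. -/
private theorem infinity_far_data {M a ω Λ : ℝ} {m : ℤ} (hM : 0 < M) (ha : |a| < M)
    (hω : ω ≠ 0) (hadm : Kerr.IsAdmissibleTriple a ω m Λ) {R : ℝ → ℂ}
    (hR : Kerr.IsRadialTeukolskySolution M a 0 ω m (Λ - a ^ 2 * ω ^ 2) R)
    (hn : Kerr.IsNormalisedInfinitySolution M 0 ω R) {r : ℝ}
    (hr : max (7 * M) (max (Real.sqrt (12 * Λ) / |ω|) (1 / (M * ω ^ 2))) ≤ r) :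
    Real.sqrt (r ^ 2 + a ^ 2) * ‖R r‖ ≤ 2 ∧
      Kerr.delta M a r / (r ^ 2 + a ^ 2) *
          ‖deriv (fun s : ℝ ↦ ((Real.sqrt (s ^ 2 + a ^ 2) : ℝ) : ℂ) * R s) r‖ ≤
        Real.sqrt 2 * |ω| := by
  obtain ⟨h1, h2⟩ := Kerr.Costa2019.farEnvelope hM ha hω hadm hR hn hr
  have h7 : 7 * M ≤ r := le_of_max_le_left hr
  have hr0 : 0 < r := by linarith
  have hA : 0 ≤ r ^ 2 + a ^ 2 := by positivity
  have hΔ : 0 ≤ Kerr.delta M a r / (r ^ 2 + a ^ 2) :=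
    le_trans (by norm_num) (Kerr.IsTortoiseRadius.five_div_seven_le_deriv ha h7)
  constructor
  · have h3 : (Real.sqrt (r ^ 2 + a ^ 2) * ‖R r‖) ^ 2 ≤ 2 ^ 2 := by
      rw [mul_pow, Real.sq_sqrt hA]; linarith
    exact (pow_le_pow_iff_left₀ (by positivity) zero_le_two two_ne_zero).1 h3
  · have h3 : (Kerr.delta M a r / (r ^ 2 + a ^ 2) *
        ‖deriv (fun s : ℝ ↦ ((Real.sqrt (s ^ 2 + a ^ 2) : ℝ) : ℂ) * R s) r‖) ^ 2 ≤
        (Real.sqrt 2 * |ω|) ^ 2 := by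
      rw [mul_pow, mul_pow, Real.sq_sqrt zero_le_two, sq_abs]; exact h2
    exact (pow_le_pow_iff_left₀ (mul_nonneg hΔ (norm_nonneg _)) (by positivity) two_ne_zero).1 h3

/-! ### Geometry of the blown-up chart on the box -/

/-- **The chart constants.** For `0 < M`, `|a| < M`, with `d = r₊ − r₋` and `κ = Kerr.surfaceGravity M a`:
`0 < d ≤ 2M`, `2κM² ≤ d = 2κ(r₊² + a²)` (so `1/d ≤ κ⁻¹/(2M²)`), `0 < κ` and `4M ≤ κ⁻¹`. -/
private theorem chart_constants {M a : ℝ} (hM : 0 < M) (ha : |a| < M) :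
    0 < Kerr.rPlus M a - Kerr.rMinus M a ∧ Kerr.rPlus M a - Kerr.rMinus M a ≤ 2 * M ∧
      2 * Kerr.surfaceGravity M a * M ^ 2 ≤ Kerr.rPlus M a - Kerr.rMinus M a ∧
      0 < Kerr.surfaceGravity M a ∧ 4 * M ≤ (Kerr.surfaceGravity M a)⁻¹ := by
  have hsub : Kerr.IsSubextremal M a := ha
  have hd0 : 0 < Kerr.rPlus M a - Kerr.rMinus M a := sub_pos.2 hsub.rMinus_lt_rPlus
  have hd2 : Kerr.rPlus M a - Kerr.rMinus M a ≤ 2 * M := by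
    rw [Kerr.rPlus_sub_rMinus]
    have : √(M ^ 2 - a ^ 2) ≤ M := by
      rw [Real.sqrt_le_left hM.le]; nlinarith [sq_nonneg a]
    linarith
  have hκ : 0 < Kerr.surfaceGravity M a := hsub.surfaceGravity_pos
  have hA : 0 < Kerr.rPlus M a ^ 2 + a ^ 2 := by
    have := Kerr.rPlus_pos hM a; positivity
  have hdκ : Kerr.rPlus M a - Kerr.rMinus M a =
      2 * Kerr.surfaceGravity M a * (Kerr.rPlus M a ^ 2 + a ^ 2) := by
    rw [Kerr.surfaceGravity_eq_rPlus_sub_rMinus_div]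
    field_simp
  have hMr : M ≤ Kerr.rPlus M a := Kerr.M_le_rPlus M a
  have hM2 : M ^ 2 ≤ Kerr.rPlus M a ^ 2 + a ^ 2 := by nlinarith [sq_nonneg a]
  have hκ4 : 4 * M ≤ (Kerr.surfaceGravity M a)⁻¹ := by
    have h := Kerr.surfaceGravity_le hM a
    rw [le_inv_comm₀ (by positivity) hκ]
    calc Kerr.surfaceGravity M a ≤ 1 / (4 * M) := h
      _ = (4 * M)⁻¹ := one_div _
  refine ⟨hd0, hd2, ?_, hκ, hκ4⟩
  rw [hdκ]
  exact mul_le_mul_of_nonneg_left hM2 (by positivity)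

/-! ### Bookkeeping: a polynomial in `X₀ ≤ α κ⁻¹` is a power of `κ⁻¹` -/

/-- **Monomial bookkeeping.** If `1 ≤ X ≤ αY`, `0 < θ`, `0 ≤ F, h, B` and
`w ≤ F·(X/θ)^{n+1}·((X+1)²·h)`, then `B·w ≤ (B·F·(4h)/θ^{n+1}·α^{n+3})·Y^{n+3}`
(`(X+1)² ≤ 4X²`, `X^{n+3} ≤ (αY)^{n+3}`). -/
private theorem monomial_bookkeeping {X Y α θ F h w B : ℝ} {n : ℕ} (hX1 : 1 ≤ X) (hXY : X ≤ α * Y)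
    (hθ : 0 < θ) (hF : 0 ≤ F) (hh : 0 ≤ h) (hB : 0 ≤ B)
    (hw : w ≤ F * (X / θ) ^ (n + 1) * ((X + 1) ^ 2 * h)) :
    B * w ≤ B * F * (4 * h) / θ ^ (n + 1) * α ^ (n + 3) * Y ^ (n + 3) := by
  have hX0 : 0 ≤ X := zero_le_one.trans hX1
  have h1 : (X + 1) ^ 2 ≤ 4 * X ^ 2 := by nlinarith
  have h2 : X ^ (n + 3) ≤ (α * Y) ^ (n + 3) := pow_le_pow_left₀ hX0 hXY _
  have hθp : 0 < θ ^ (n + 1) := pow_pos hθ _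
  have h3 : F * (X / θ) ^ (n + 1) * ((X + 1) ^ 2 * h) ≤
      F * (4 * h) / θ ^ (n + 1) * α ^ (n + 3) * Y ^ (n + 3) := by
    rw [div_pow]
    calc F * (X ^ (n + 1) / θ ^ (n + 1)) * ((X + 1) ^ 2 * h)
        = F * h / θ ^ (n + 1) * (X ^ (n + 1) * (X + 1) ^ 2) := by ring
      _ ≤ F * h / θ ^ (n + 1) * (X ^ (n + 1) * (4 * X ^ 2)) := by gcongr
      _ = F * (4 * h) / θ ^ (n + 1) * X ^ (n + 3) := by ring
      _ ≤ F * (4 * h) / θ ^ (n + 1) * (α * Y) ^ (n + 3) := by gcongr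
      _ = F * (4 * h) / θ ^ (n + 1) * α ^ (n + 3) * Y ^ (n + 3) := by rw [mul_pow]; ring
  calc B * w ≤ B * (F * (X / θ) ^ (n + 1) * ((X + 1) ^ 2 * h)) := mul_le_mul_of_nonneg_left hw hB
    _ ≤ B * (F * (4 * h) / θ ^ (n + 1) * α ^ (n + 3) * Y ^ (n + 3)) :=
        mul_le_mul_of_nonneg_left h3 hB
    _ = B * F * (4 * h) / θ ^ (n + 1) * α ^ (n + 3) * Y ^ (n + 3) := by ring

/-! ### The registered stub -/

/-- **T1i · `stub_infinitySupBoxPoly` — polynomial sup bound for the infinity-normalised solution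
beyond the collar, on a bounded box.** For `M > 0`, `θ > 0`, `ξ₀ > 0` and every `Λ₀` there are
`a₁ < M`, `ε₀ > 0`, `C > 0`, `N` such that for `a₁ ≤ |a| < M`, admissible `(ω, m, Λ)` with `m ≠ 0`,
`Λ ≤ Λ₀`, `|ω − mω₊| ≤ ε₀|m|` (and the threshold/superradiant restriction, which is NOT used),
every classical radial solution `R_𝓘` normalised at `𝓘⁺` obeys
`√(r′² + a²)‖R_𝓘(r′)‖ ≤ C Λ^N κ^{-N}` for all `r′ ≥ r₊ + θ(r₊ − r₋)`.

Proof (inward from infinity, `a₁ = M/2`, `ε₀ = 1/(16M)`, box constants `Kerr.cone_box_constants`):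
(1) FAR `r′ ≥ R₀ = 256Mμ` (`μ = √(max Λ₀ 2)`): `√(r′² + a²)‖R_𝓘‖ ≤ 2` (`infinity_far_data`);
(2) otherwise `x′ = (r′ − r₊)/(r₊ − r₋) ∈ [θ, X₀)`, `X₀ = (R₀ − r₊)/(r₊ − r₋) ≤ (128μ/M)κ⁻¹`: the
blown-up normal form `W″ = QW` (`stub_olverNormalForm`), the handover at `X₀` (`Kerr.throat_handover` fed
by `infinity_far_data` at `R₀`: `‖W X₀‖ + X₀‖W′ X₀‖ ≤ (X₀+1)²·h₀`), and the a priori transport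
across the throat `Kerr.throat_norm_le` (Euler zone + oscillatory pocket, uniform in
`ξ = (ω − mω₊)/(2κ)`) give `‖W x′‖ ≤ F·(X₀/θ)^{n+1}·(X₀+1)²h₀` with box constants `F, h₀, n`; finally
`√(r′² + a²)‖R_𝓘 r′‖ = (√(r′² + a²)/√(x′(x′+1)))‖W x′‖ ≤ ((R₀ + M)/θ)‖W x′‖` and
`monomial_bookkeeping` (`X₀ ≥ 1`, `κ⁻¹ ≥ 4M`, `Λ ≥ 1`). -/
theorem stub_infinitySupBoxPoly :
    (∀ M : ℝ, 0 < M → ∀ θ : ℝ, 0 < θ → ∀ ξ₀ : ℝ, 0 < ξ₀ → ∀ Λ₀ : ℝ, ∃ (a₁ ε₀ C : ℝ) (N : ℕ), a₁ < M ∧ 0 < ε₀ ∧ 0 < C ∧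
      ∀ a : ℝ, a₁ ≤ |a| → Kerr.IsSubextremal M a →
        ∀ (ω : ℝ) (m : ℤ) (Λ : ℝ), Kerr.IsAdmissibleTriple a ω m Λ → m ≠ 0 → Λ ≤ Λ₀ →
          |ω - m * Kerr.horizonAngularVelocity M a| ≤ ε₀ * |(m : ℝ)| →
          (ω * (ω - m * Kerr.horizonAngularVelocity M a) ≤ 0 ∨
              |ω - m * Kerr.horizonAngularVelocity M a| ≤ 2 * ξ₀ * Kerr.surfaceGravity M a) →
            ∀ RI : ℝ → ℂ,
              Kerr.IsRadialTeukolskySolution M a 0 ω m (Λ - a ^ 2 * ω ^ 2) RI →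
              Kerr.IsNormalisedInfinitySolution M 0 ω RI →
                ∀ r' : ℝ, Kerr.rPlus M a + θ * (Kerr.rPlus M a - Kerr.rMinus M a) ≤ r' →
                  Real.sqrt (r' ^ 2 + a ^ 2) * ‖RI r'‖ ≤ C * Λ ^ N * (Kerr.surfaceGravity M a)⁻¹ ^ N) := by
  intro M hM θ hθ ξ₀ _hξ₀ Λ₀
  -- box constants (depend on `M, θ, Λ₀` only)
  obtain ⟨μ, hμ_def⟩ : ∃ μ : ℝ, μ = Real.sqrt (max Λ₀ 2) := ⟨_, rfl⟩
  have hμ1 : 1 ≤ μ := by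
    rw [hμ_def, Real.le_sqrt zero_le_one (le_max_of_le_right zero_le_two), one_pow]
    exact le_max_of_le_right (by norm_num)
  have hμ0 : 0 < μ := one_pos.trans_le hμ1
  obtain ⟨R₀, hR₀_def⟩ : ∃ R₀ : ℝ, R₀ = 256 * M * μ := ⟨_, rfl⟩
  have hR₀M : 256 * M ≤ R₀ := by rw [hR₀_def]; nlinarith
  have hR₀0 : 0 < R₀ := by rw [hR₀_def]; positivity
  obtain ⟨G, hG_def⟩ : ∃ G : ℝ, G = μ * (4 + 512 * μ) := ⟨_, rfl⟩
  have hG0 : 0 ≤ G := by rw [hG_def]; positivity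
  have hGμ : μ ≤ G + 1 := by rw [hG_def]; nlinarith
  obtain ⟨L₀, hL₀_def⟩ : ∃ L₀ : ℝ, L₀ = 2 * μ ^ 2 := ⟨_, rfl⟩
  obtain ⟨θ₁, hθ₁_def⟩ : ∃ θ₁ : ℝ, θ₁ = min 1 θ := ⟨_, rfl⟩
  have hθ₁0 : 0 < θ₁ := by rw [hθ₁_def]; exact lt_min one_pos hθ
  have hθ₁1 : θ₁ ≤ 1 := by rw [hθ₁_def]; exact min_le_left _ _
  obtain ⟨c, hc_def⟩ : ∃ c : ℝ, c = θ₁ / (144 * (G + 1)) := ⟨_, rfl⟩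
  have hc0 : 0 < c := by rw [hc_def]; positivity
  have hc1 : c ≤ 1 := by
    rw [hc_def, div_le_one (by positivity)]; nlinarith
  have hcG : c * G ≤ 1 / 144 := by
    rw [hc_def, div_mul_eq_mul_div, div_le_div_iff₀ (by positivity) (by norm_num)]
    nlinarith [mul_nonneg hθ₁0.le hG0]
  have hcL : 32 * L₀ * c ^ 2 ≤ min 1 θ := by
    rw [← hθ₁_def, hL₀_def]
    -- `64 μ² c² ≤ 64 μ² θ₁² / (144² μ²) ≤ θ₁`
    have h1 : c * (G + 1) = θ₁ / 144 := by rw [hc_def]; field_simp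
    have h2 : c * μ ≤ θ₁ / 144 := by
      rw [← h1]; exact mul_le_mul_of_nonneg_left hGμ hc0.le
    have h3 : (c * μ) ^ 2 ≤ (θ₁ / 144) ^ 2 := pow_le_pow_left₀ (by positivity) h2 2
    nlinarith
  obtain ⟨n, hn_def⟩ : ∃ n : ℕ, n = ⌈L₀ + 1 / 4 + 2 / c ^ 2 + 2 * G ^ 2⌉₊ + 1 := ⟨_, rfl⟩
  have hn1 : 1 ≤ n := by rw [hn_def]; exact Nat.le_add_left 1 _
  have hn1' : (1 : ℝ) ≤ n := by exact_mod_cast hn1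
  have hK : L₀ + 1 / 4 + 2 / c ^ 2 + 2 * G ^ 2 ≤ (n : ℝ) ^ 2 := by
    have h1 : L₀ + 1 / 4 + 2 / c ^ 2 + 2 * G ^ 2 ≤ (n : ℝ) := by
      rw [hn_def]; push_cast
      exact (Nat.le_ceil _).trans (le_add_of_nonneg_right zero_le_one)
    exact h1.trans (by simpa using le_self_pow₀ hn1' two_ne_zero)
  -- handover constant `h₀` (with `A = 2`, `B = 2μ/M`), throat factor `F`, chart slope `α`
  obtain ⟨h₀, hh₀_def⟩ : ∃ h₀ : ℝ, h₀ = 3 * 2 / R₀ + 2 * M * (2 * (2 * μ / M) + 2 / R₀) / R₀ := ⟨_, rfl⟩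
  have hh₀ : 0 ≤ h₀ := by rw [hh₀_def]; positivity
  obtain ⟨F, hF_def⟩ : ∃ F : ℝ, F = (1 + 2 * c * (1 + θ⁻¹)) * (2 * n) := ⟨_, rfl⟩
  have hF : 0 ≤ F := by rw [hF_def]; positivity
  obtain ⟨α, hα_def⟩ : ∃ α : ℝ, α = 128 * μ / M := ⟨_, rfl⟩
  have hα : 0 ≤ α := by rw [hα_def]; positivity
  obtain ⟨CB, hCB_def⟩ : ∃ CB : ℝ, CB = (R₀ + M) / θ * F * (4 * h₀) / θ ^ (n + 1) * α ^ (n + 3) := ⟨_, rfl⟩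
  have hCB : 0 ≤ CB := by rw [hCB_def]; positivity
  refine ⟨M / 2, 1 / (16 * M), CB + 2 / (4 * M) ^ (n + 3), n + 3, by linarith, by positivity,
    by positivity, ?_⟩
  intro a ha₁ hsub ω m Λ hadm hm hΛ hcone _hreg RI hI hnI r' hr'
  have ha : |a| < M := hsub
  obtain ⟨hω0, hω16, hωμ', hΛ1, hΛμ', hmμ', hLμ', hRfar', hK₀'⟩ := Kerr.cone_box_constants hM ha₁ ha hadm hm hΛ hcone
  -- rewrite the `√(max Λ₀ 2)` of `box_constants` as `μ`
  rw [← hμ_def] at hωμ' hΛμ' hmμ' hLμ' hRfar' hK₀'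
  rw [← hR₀_def] at hRfar'
  obtain ⟨hd0, hd2, hdM, hκ, hκ4⟩ := chart_constants hM ha
  set d := Kerr.rPlus M a - Kerr.rMinus M a with hd_def
  set κ := Kerr.surfaceGravity M a with hκ_def
  have hY0 : 0 ≤ κ⁻¹ := (inv_pos.2 hκ).le
  have hΛN : (1 : ℝ) ≤ Λ ^ (n + 3) := one_le_pow₀ hΛ1
  have hrp : 0 < Kerr.rPlus M a := Kerr.rPlus_pos hM a
  have hr2M : Kerr.rPlus M a ≤ 2 * M := Kerr.rPlus_le_two_mul_self hM.le a
  have hr'0 : 0 < r' := by have := mul_pos hθ hd0; linarith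
  rcases le_or_gt R₀ r' with hfar | hnear
  · -- (1) the far zone
    have h2 := (infinity_far_data hM ha hω0 hadm hI hnI (hRfar'.trans hfar)).1
    have h4 : (2 : ℝ) ≤ 2 / (4 * M) ^ (n + 3) * (κ⁻¹) ^ (n + 3) := by
      rw [div_mul_eq_mul_div, le_div_iff₀ (by positivity)]
      exact mul_le_mul_of_nonneg_left (pow_le_pow_left₀ (by positivity) hκ4 _) zero_le_two
    calc Real.sqrt (r' ^ 2 + a ^ 2) * ‖RI r'‖ ≤ 2 := h2
      _ ≤ 2 / (4 * M) ^ (n + 3) * (κ⁻¹) ^ (n + 3) := h4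
      _ ≤ 2 / (4 * M) ^ (n + 3) * Λ ^ (n + 3) * (κ⁻¹) ^ (n + 3) := by
          rw [mul_assoc]
          refine mul_le_mul_of_nonneg_left ?_ (by positivity)
          exact le_mul_of_one_le_left (by positivity) hΛN
      _ ≤ (CB + 2 / (4 * M) ^ (n + 3)) * Λ ^ (n + 3) * (κ⁻¹) ^ (n + 3) := by
          gcongr; linarith
  · -- (2) the throat `θ ≤ x' < X₀`
    obtain ⟨X₀, hX₀_def⟩ : ∃ X₀ : ℝ, X₀ = (R₀ - Kerr.rPlus M a) / d := ⟨_, rfl⟩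
    obtain ⟨x', hx'_def⟩ : ∃ x' : ℝ, x' = (r' - Kerr.rPlus M a) / d := ⟨_, rfl⟩
    have hR₀eq : R₀ = Kerr.rPlus M a + d * X₀ := by rw [hX₀_def]; field_simp; ring
    have hr'eq : r' = Kerr.rPlus M a + d * x' := by rw [hx'_def]; field_simp; ring
    have hx'θ : θ ≤ x' := by rw [hx'_def, le_div_iff₀ hd0]; linarith
    have hx'X : x' < X₀ := by rw [hx'_def, hX₀_def]; exact div_lt_div_of_pos_right (by linarith) hd0
    have hx'0 : 0 < x' := hθ.trans_le hx'θ
    have hθX : θ ≤ X₀ := hx'θ.trans hx'X.le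
    have hX₀0 : 0 < X₀ := hθ.trans_le hθX
    -- `X₀ ≥ 1`, `254 M μ / d ≤ X₀`, `X₀ ≤ α κ⁻¹`, `d X₀ ≤ R₀`
    have hX₀low : 254 * M * μ / d ≤ X₀ := by
      rw [hX₀_def]
      apply div_le_div_of_nonneg_right _ hd0.le
      have h := mul_le_mul_of_nonneg_left hμ1 (by positivity : (0 : ℝ) ≤ 2 * M)
      rw [hR₀_def]; linarith
    have hX₀1 : 1 ≤ X₀ := by
      refine le_trans ?_ hX₀low
      rw [le_div_iff₀ hd0, one_mul]
      have h := mul_le_mul_of_nonneg_left hμ1 (by positivity : (0 : ℝ) ≤ 254 * M)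
      linarith
    have hκne : κ ≠ 0 := hκ.ne'
    have hX₀α : X₀ ≤ α * κ⁻¹ := by
      rw [hX₀_def, div_le_iff₀ hd0, hα_def]
      have h1 : R₀ - Kerr.rPlus M a ≤ R₀ := by linarith
      have h2 : R₀ ≤ 128 * μ / M * κ⁻¹ * d := by
        calc R₀ = 128 * μ / M * κ⁻¹ * (2 * κ * M ^ 2) := by
              rw [hR₀_def]; field_simp; ring
          _ ≤ 128 * μ / M * κ⁻¹ * d := mul_le_mul_of_nonneg_left hdM (by positivity)
      exact h1.trans h2
    have hdX₀ : d * X₀ ≤ R₀ := by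
      rw [hX₀_def, mul_div_cancel₀ _ hd0.ne']; linarith
    -- the blown-up normal form
    obtain ⟨W', W'', hWall⟩ := ((stub_olverNormalForm.1 M a ω m Λ hM ha RI).1 hI)
    set L := Λ - 2 * a * m * ω with hL_def
    set k₀ := Kerr.radialK a ω m (Kerr.rPlus M a) / d with hk₀_def
    set Q : ℝ → ℝ := fun x ↦ ((Λ - 2 * a * m * ω) * (x * (x + 1)) -
        (Kerr.radialK a ω m (Kerr.rPlus M a + (Kerr.rPlus M a - Kerr.rMinus M a) * x) /
          (Kerr.rPlus M a - Kerr.rMinus M a)) ^ 2 - 1 / 4) / (x * (x + 1)) ^ 2 with hQ_def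
    have hQ : ∀ x, 0 < x → Q x =
        (L * (x * (x + 1)) - (k₀ + ω * x * (2 * Kerr.rPlus M a + d * x)) ^ 2 - 1 / 4) /
          (x * (x + 1)) ^ 2 := by
      intro x _
      simp only [hQ_def, hL_def, hk₀_def, ← hd_def]
      rw [Kerr.radialK_add_mul_div a ω m (Kerr.rPlus M a) x hd0.ne']
    have hW : ∀ x, 0 < x →
        HasDerivAt (fun y : ℝ ↦ ((Real.sqrt (y * (y + 1)) : ℝ) : ℂ) *
          RI (Kerr.rPlus M a + d * y)) (W' x) x ∧
        HasDerivAt W' ((Q x : ℂ) * (((Real.sqrt (x * (x + 1)) : ℝ) : ℂ) *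
          RI (Kerr.rPlus M a + d * x))) x := by
      intro x hx
      obtain ⟨h1, h2, h3⟩ := hWall x hx
      refine ⟨h1, ?_⟩
      rw [h3] at h2
      exact h2
    -- hypotheses of the throat transport
    have hLL : |L| ≤ L₀ := by rw [hL₀_def]; exact hLμ'
    have hkX : c * |k₀| ≤ X₀ := by
      have h1 : |k₀| = |Kerr.radialK a ω m (Kerr.rPlus M a)| / d := by
        rw [hk₀_def, abs_div, abs_of_pos hd0]
      have h2 : |k₀| ≤ M * μ / 4 / d := by
        rw [h1]; exact div_le_div_of_nonneg_right hK₀' hd0.le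
      have h3 : c * |k₀| ≤ M * μ / 4 / d :=
        (mul_le_of_le_one_left (abs_nonneg _) hc1).trans h2
      refine h3.trans (le_trans ?_ hX₀low)
      have hMμ := mul_pos hM hμ0
      exact div_le_div_of_nonneg_right (by linarith) hd0.le
    have hg : ∀ x ∈ Icc 0 X₀, |ω * (2 * Kerr.rPlus M a + d * x)| ≤ G ∧
        |ω * (2 * Kerr.rPlus M a + 2 * d * x)| ≤ G := by
      intro x hx
      have hdx : d * x ≤ R₀ := (mul_le_mul_of_nonneg_left hx.2 hd0.le).trans hdX₀
      have hdx0 : 0 ≤ d * x := mul_nonneg hd0.le hx.1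
      have h1 : |2 * Kerr.rPlus M a + d * x| ≤ 4 * M + 2 * R₀ := by
        rw [abs_of_nonneg (by linarith)]; linarith
      have h2 : |2 * Kerr.rPlus M a + 2 * d * x| ≤ 4 * M + 2 * R₀ := by
        rw [abs_of_nonneg (by linarith)]; linarith
      have h3 : |ω| * (4 * M + 2 * R₀) ≤ G := by
        calc |ω| * (4 * M + 2 * R₀) ≤ μ / M * (4 * M + 2 * R₀) :=
              mul_le_mul_of_nonneg_right hωμ' (by positivity)
          _ = G := by rw [hG_def, hR₀_def]; field_simp; ring
      constructor
      · rw [abs_mul]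
        exact (mul_le_mul_of_nonneg_left h1 (abs_nonneg _)).trans h3
      · rw [abs_mul]
        exact (mul_le_mul_of_nonneg_left h2 (abs_nonneg _)).trans h3
    have hT := Kerr.throat_norm_le hQ hW hθ hθX hLL hc0 hkX hg hcG hcL hn1 hK x' ⟨hx'θ, hx'X.le⟩
    -- the handover at `X₀` (radius `R₀`)
    obtain ⟨hA, hB⟩ := infinity_far_data hM ha hω0 hadm hI hnI (r := R₀) hRfar'
    have hB' : Kerr.delta M a R₀ / (R₀ ^ 2 + a ^ 2) *
        ‖deriv (fun s : ℝ ↦ ((Real.sqrt (s ^ 2 + a ^ 2) : ℝ) : ℂ) * RI s) R₀‖ ≤ 2 * μ / M := by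
      refine hB.trans ?_
      have hs2 : Real.sqrt 2 ≤ 2 := by
        rw [Real.sqrt_le_left zero_le_two]; norm_num
      calc Real.sqrt 2 * |ω| ≤ 2 * (μ / M) := mul_le_mul hs2 hωμ' (abs_nonneg _) zero_le_two
        _ = 2 * μ / M := by ring
    have hR₀p : Kerr.rPlus M a < R₀ := by linarith
    obtain ⟨R', R'', hRall⟩ := hI
    have hRd : HasDerivAt RI (R' R₀) R₀ := (hRall R₀ hR₀p).1
    have h7 : 7 * M ≤ R₀ := by linarith
    have hH := Kerr.throat_handover hM ha rfl hX₀1 hR₀eq h7 hRd (hW X₀ hX₀0).1 hA hB'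
    rw [← hh₀_def] at hH
    -- `‖W X₀‖` in the form of the transport bound
    have hWX₀ : ‖((Real.sqrt (X₀ * (X₀ + 1)) : ℝ) : ℂ) * RI (Kerr.rPlus M a + d * X₀)‖ +
        X₀ * ‖W' X₀‖ ≤ (X₀ + 1) ^ 2 * h₀ := by rw [← hR₀eq]; exact hH
    -- the bound for `‖W x'‖`
    have hWx' : ‖((Real.sqrt (x' * (x' + 1)) : ℝ) : ℂ) * RI (Kerr.rPlus M a + d * x')‖ ≤
        F * (X₀ / θ) ^ (n + 1) * ((X₀ + 1) ^ 2 * h₀) := by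
      refine hT.trans ?_
      rw [hF_def]
      have h0 : 0 ≤ (1 + 2 * c * (1 + θ⁻¹)) * (2 * n) * (X₀ / θ) ^ (n + 1) := by positivity
      calc (1 + 2 * c * (1 + θ⁻¹)) * (2 * ↑n * (X₀ / θ) ^ (n + 1) *
            (‖((Real.sqrt (X₀ * (X₀ + 1)) : ℝ) : ℂ) * RI (Kerr.rPlus M a + d * X₀)‖ + X₀ * ‖W' X₀‖))
          = (1 + 2 * c * (1 + θ⁻¹)) * (2 * n) * (X₀ / θ) ^ (n + 1) *
            (‖((Real.sqrt (X₀ * (X₀ + 1)) : ℝ) : ℂ) * RI (Kerr.rPlus M a + d * X₀)‖ + X₀ * ‖W' X₀‖) := by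
            ring
        _ ≤ (1 + 2 * c * (1 + θ⁻¹)) * (2 * n) * (X₀ / θ) ^ (n + 1) * ((X₀ + 1) ^ 2 * h₀) :=
            mul_le_mul_of_nonneg_left hWX₀ h0
    -- back to `R`: `√(r'² + a²)‖R r'‖ ≤ ((R₀ + M)/θ) ‖W x'‖`
    have hS : Real.sqrt (r' ^ 2 + a ^ 2) ≤ R₀ + M := by
      rw [Real.sqrt_le_left (by positivity)]
      have ha2 : a ^ 2 ≤ M ^ 2 := sq_le_sq' (abs_lt.1 ha).1.le (abs_lt.1 ha).2.le
      have hr2 : r' ^ 2 ≤ R₀ ^ 2 := pow_le_pow_left₀ hr'0.le hnear.le 2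
      have hRM := mul_pos hR₀0 hM
      have e : (R₀ + M) ^ 2 = R₀ ^ 2 + 2 * (R₀ * M) + M ^ 2 := by ring
      linarith [ha2, hr2, hRM, e]
    have hρ : θ ≤ Real.sqrt (x' * (x' + 1)) := by
      rw [Real.le_sqrt hθ.le (by positivity)]
      have h := mul_le_mul hx'θ hx'θ hθ.le hx'0.le
      have e : x' * (x' + 1) = x' * x' + x' := by ring
      have e2 : θ ^ 2 = θ * θ := sq θ
      linarith [h, hx'0, e, e2]
    have hconv : Real.sqrt (r' ^ 2 + a ^ 2) * ‖RI r'‖ ≤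
        (R₀ + M) / θ * ‖((Real.sqrt (x' * (x' + 1)) : ℝ) : ℂ) * RI (Kerr.rPlus M a + d * x')‖ := by
      rw [← hr'eq, norm_mul, Complex.norm_of_nonneg (Real.sqrt_nonneg _), div_mul_eq_mul_div,
        le_div_iff₀ hθ]
      calc Real.sqrt (r' ^ 2 + a ^ 2) * ‖RI r'‖ * θ = θ * Real.sqrt (r' ^ 2 + a ^ 2) * ‖RI r'‖ := by ring
        _ ≤ Real.sqrt (x' * (x' + 1)) * (R₀ + M) * ‖RI r'‖ := by
            apply mul_le_mul_of_nonneg_right _ (norm_nonneg _)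
            exact mul_le_mul hρ hS (Real.sqrt_nonneg _) (Real.sqrt_nonneg _)
        _ = (R₀ + M) * (Real.sqrt (x' * (x' + 1)) * ‖RI r'‖) := by ring
    have hbook := monomial_bookkeeping (B := (R₀ + M) / θ) hX₀1 hX₀α hθ hF hh₀ (by positivity) hWx'
    rw [← hCB_def] at hbook
    calc Real.sqrt (r' ^ 2 + a ^ 2) * ‖RI r'‖
        ≤ (R₀ + M) / θ * ‖((Real.sqrt (x' * (x' + 1)) : ℝ) : ℂ) * RI (Kerr.rPlus M a + d * x')‖ := hconv
      _ ≤ CB * (κ⁻¹) ^ (n + 3) := hbook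
      _ ≤ CB * Λ ^ (n + 3) * (κ⁻¹) ^ (n + 3) := by
          rw [mul_assoc]
          exact mul_le_mul_of_nonneg_left (le_mul_of_one_le_left (by positivity) hΛN) hCB
      _ ≤ (CB + 2 / (4 * M) ^ (n + 3)) * Λ ^ (n + 3) * (κ⁻¹) ^ (n + 3) := by
          gcongr; exact le_add_of_nonneg_right (by positivity)

end Summit.FinalStateConjecture.FinalStateConjecture.Theorems.KappaExplicitWaveDecay.OlverDunsterUniformReduction

end
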